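import Literature.NumberTheory.GaloisRepresentations.DecompositionGroupCommTerminal
import HarnessLib

/-!
# Decomposition groups in `Γ_K` are relatively slim (given slimness of the local Galois group)

Topic `NumberTheory/GaloisRepresentations`; theorems only (no definition, no named fact), sequel of
`DecompositionGroupCommTerminal.lean` (notation as there: `K` a number field, `v` a finite place,
`K_v = v.adicCompletion K`, `ι : K̄ → \bar K_v`, `res : Γ_{K_v} → Γ_K`, `𝔓₀ = adicCompletionPrime K v`,
`D_{𝔓₀} = res (Γ_{K_v})`).

* `absGaloisRestrict_adicCompletion_injective` — **`res : Γ_{K_v} → Γ_K` is injective** (`ι(K̄)` is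
  dense in `\bar K_v` and `Γ_{K_v}` acts by isometries), so `res : Γ_{K_v} ⥲ D_{𝔓₀}` (Neukirch,
  *Algebraic Number Theory*, Ch. II (9.6): `G_w(L|K) ≅ G(L_w|K_v)`);
* `centralizer_le_decompositionSubgroup_of_relIndex_ne_zero` — the centraliser in `Γ_K` of a
  finite-index subgroup of `D_𝔓` lies in `D_𝔓` (`𝔓 ∣ v`; by the non-commensurability theorem
  `smul_eq_of_relIndex_ne_zero_of_mem_primesAbove`);
* `eq_one_of_forall_centralizer_eq_bot` — transport of slimness along a continuous injective
  homomorphism of topological groups onto a subgroup (pure group topology);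
* **`centralizer_image_decompositionSubgroup_eq_bot`** — if every open subgroup of `Γ_{K_v}` has
  trivial centraliser (slimness of the local absolute Galois group, a theorem of the tree:
  `Literature.AnabelianGeometry.AbsoluteAnabelian.galoisMLF_slim_holds`), then for every prime
  `𝔓 ∣ v` of `\bar ℤ_K` and every open subgroup `U ⊆ D_𝔓`, the centraliser `Z_{Γ_K}(U)` is trivial:
  **`D_𝔓 ↪ Γ_K` is relatively slim** (Mochizuki, *The absolute anabelian geometry of hyperbolic
  curves* (2004), Thm. 1.1.1 (ii), first clause).

## References

* S. Mochizuki, *The absolute anabelian geometry of hyperbolic curves*, Galois theory and modular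
  forms, Kluwer (2004), Thm. 1.1.1 (ii). [MochizukiAbsAnab2004]
* J. Neukirch, A. Schmidt, K. Wingberg, *Cohomology of Number Fields* (2nd ed. 2008), Cor. 12.1.3.
  [NeukirchSchmidtWingberg2008]
* J. Neukirch, *Algebraic Number Theory*, Grundlehren 322 (1999), Ch. II §9 (9.6). [NeukirchANT1999]
-/

noncomputable section

open scoped NumberField Pointwise Valued
open Field IsDedekindDomain

universe u

namespace Literature.NumberTheory.GaloisRepresentations

/-! ### Transport of slimness along an injective continuous homomorphism -/

/-- **Transport of slimness.**  Let `f : H → G` be a continuous injective homomorphism of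
topological groups with image the subgroup `D`, and suppose every open subgroup of `H` has
trivial centraliser in `H`.  If `σ ∈ D` centralises the image of an open subgroup `U` of `D`
(for the subspace topology of `D`), then `σ = 1` (the mechanism of [AbsAnab] Rmk 0.1.1–0.1.2:
slimness statements transported along injections). [cite: MochizukiAbsAnab2004, Rmk 0.1.2 p.4] -/
theorem eq_one_of_forall_centralizer_eq_bot {H G : Type*} [Group H] [TopologicalSpace H]
    [Group G] [TopologicalSpace G] (f : H →* G) (hf : Continuous f) (hinj : Function.Injective f)
    (hslim : ∀ V : Subgroup H, IsOpen (V : Set H) → Subgroup.centralizer (V : Set H) = ⊥)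
    (D : Subgroup G) (hD : ∀ x, x ∈ D ↔ x ∈ f.range) (U : Subgroup D) (hU : IsOpen (U : Set D))
    {σ : G} (hσD : σ ∈ D) (hσ : σ ∈ Subgroup.centralizer (D.subtype '' (U : Set D))) : σ = 1 := by
  obtain ⟨τ, rfl⟩ : σ ∈ f.range := (hD σ).mp hσD
  -- the open subgroup `f⁻¹(U)` of `H`
  set V : Subgroup H := (U.map D.subtype).comap f with hV
  have hVopen : IsOpen (V : Set H) := by
    obtain ⟨W, hW, hWU⟩ := isOpen_induced_iff.mp hU
    have hVW : (V : Set H) = f ⁻¹' W := by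
      ext h
      simp only [hV, SetLike.mem_coe, Subgroup.mem_comap, Subgroup.mem_map, Subgroup.coe_subtype,
        Set.mem_preimage]
      constructor
      · rintro ⟨u, hu, hfu⟩
        have : (u : G) ∈ W := by
          have hu' : u ∈ (Subtype.val ⁻¹' W : Set D) := by rw [hWU]; exact hu
          exact hu'
        rwa [hfu] at this
      · intro hW'
        have hfD : f h ∈ D := (hD _).mpr ⟨h, rfl⟩
        refine ⟨⟨f h, hfD⟩, ?_, rfl⟩
        have : (⟨f h, hfD⟩ : D) ∈ (Subtype.val ⁻¹' W : Set D) := hW'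
        rw [hWU] at this
        exact this
    rw [hVW]
    exact hW.preimage hf
  -- `τ` centralises `V`
  have hτ : τ ∈ Subgroup.centralizer (V : Set H) := by
    rw [Subgroup.mem_centralizer_iff]
    intro h hh
    apply hinj
    rw [map_mul, map_mul]
    have hfh : f h ∈ D.subtype '' (U : Set D) := by
      obtain ⟨u, hu, hfu⟩ := Subgroup.mem_comap.mp hh
      exact ⟨u, hu, hfu⟩
    exact (Subgroup.mem_centralizer_iff.mp hσ) (f h) hfh
  rw [hslim V hVopen, Subgroup.mem_bot] at hτ
  rw [hτ, map_one]

variable (K : Type u) [Field K] [NumberField K] (v : HeightOneSpectrum (𝓞 K))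

/-! ### `res : Γ_{K_v} → Γ_K` is injective -/

/-- **Injectivity of `res : Γ_{K_v} → Γ_K`** (so `Γ_{K_v} ⥲ D_{𝔓₀}`): two elements of `Γ_{K_v}`
with the same restriction agree on the dense subfield `ι(K̄)` of `\bar K_v`
(`exists_spectralNorm_sub_absClosureEmbedding_lt`) and act by isometries of the spectral norm
(`spectralNorm_absoluteGaloisGroup_smul`), hence agree.  Neukirch, *Algebraic Number Theory*,
Ch. II §9, Prop. (9.6) (`G(L_w|K_v) → G_w(L|K)` is injective). [cite: NeukirchANT1999, Ch. II §9 Prop. (9.6)] -/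
theorem absGaloisRestrict_adicCompletion_injective :
    Function.Injective (absGaloisRestrict K (v.adicCompletion K)) := by
  intro σ τ h
  letI : NormedField (AlgebraicClosure (v.adicCompletion K)) :=
    spectralNorm.normedField (v.adicCompletion K) (AlgebraicClosure (v.adicCompletion K))
  haveI : IsUltrametricDist (AlgebraicClosure (v.adicCompletion K)) :=
    IsUltrametricDist.isUltrametricDist_of_forall_norm_add_le_max_norm isNonarchimedean_spectralNorm
  apply FaithfulSMul.eq_of_smul_eq_smul (α := AlgebraicClosure (v.adicCompletion K))
  intro y
  have key : ∀ ε : ℝ, 0 < ε → ‖σ • y - τ • y‖ < ε := by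
    intro ε hε
    obtain ⟨x, hx⟩ := exists_spectralNorm_sub_absClosureEmbedding_lt
      (IsDedekindDomain.HeightOneSpectrum.denseRange_algebraMap (K := K) (v := v)) y hε
    change ‖y - absClosureEmbedding K (v.adicCompletion K) x‖ < ε at hx
    have h1 : σ • absClosureEmbedding K (v.adicCompletion K) x =
        τ • absClosureEmbedding K (v.adicCompletion K) x := by
      rw [← absGaloisRestrict_apply_smul, ← absGaloisRestrict_apply_smul, h]
    have e : σ • y - τ • y = σ • (y - absClosureEmbedding K (v.adicCompletion K) x) +
        τ • (absClosureEmbedding K (v.adicCompletion K) x - y) := by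
      rw [smul_sub, smul_sub, h1]
      abel
    have hiso : ∀ (ρ : absoluteGaloisGroup (v.adicCompletion K))
        (z : AlgebraicClosure (v.adicCompletion K)), ‖ρ • z‖ = ‖z‖ :=
      fun ρ z => spectralNorm_absoluteGaloisGroup_smul ρ z
    rw [e]
    refine (IsUltrametricDist.norm_add_le_max _ _).trans_lt (max_lt ?_ ?_)
    · rwa [hiso]
    · rwa [hiso, norm_sub_rev]
  have h0 : ‖σ • y - τ • y‖ ≤ 0 :=
    le_of_forall_pos_lt_add fun ε hε => by rw [zero_add]; exact key ε hε
  exact sub_eq_zero.mp (norm_le_zero_iff.mp h0)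

/-! ### Centralisers of open subgroups of `D_𝔓` -/

-- the pointwise `MulAction` of `Γ_K` on the ideals of `\bar ℤ_K` is slow to synthesise
set_option synthInstance.maxHeartbeats 160000 in
/-- The centraliser in `Γ_K` of a subgroup `U ⊆ D_𝔓` of finite index lies in `D_𝔓` (`𝔓 ∣ v` a prime
of `\bar ℤ_K`): for `σ ∈ Z(U)` one has `U ⊆ D_𝔓 ∩ D_{σ 𝔓}`, so `σ 𝔓 = 𝔓` by
`smul_eq_of_relIndex_ne_zero_of_mem_primesAbove`. [cite: NeukirchSchmidtWingberg2008, Cor. 12.1.3] -/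
theorem centralizer_le_decompositionSubgroup_of_relIndex_ne_zero {𝔓 : Ideal (absIntegers (𝓞 K) K)}
    (h𝔓 : 𝔓 ∈ v.primesAbove) {U : Subgroup (absoluteGaloisGroup K)}
    (hU : U ≤ 𝔓.decompositionSubgroup (absoluteGaloisGroup K))
    (hfin : U.relIndex (𝔓.decompositionSubgroup (absoluteGaloisGroup K)) ≠ 0) :
    Subgroup.centralizer (U : Set (absoluteGaloisGroup K)) ≤
      𝔓.decompositionSubgroup (absoluteGaloisGroup K) := by
  intro σ hσ
  rw [Ideal.mem_decompositionSubgroup_iff]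
  refine smul_eq_of_relIndex_ne_zero_of_mem_primesAbove K v h𝔓 σ fun h0 => hfin ?_
  refine Subgroup.relIndex_eq_zero_of_le_left (fun u hu => ?_) h0
  rw [Ideal.mem_decompositionSubgroup_iff]
  have hc : u * σ = σ * u := (Subgroup.mem_centralizer_iff.mp hσ) u hu
  have hu' : u • 𝔓 = 𝔓 := Ideal.mem_decompositionSubgroup_iff.mp (hU hu)
  rw [smul_smul, hc, ← smul_smul, hu']

/-- `D_{γ • 𝔓₀}` is the image of `τ ↦ γ (res τ) γ⁻¹`. [cite: NeukirchANT1999, Ch. II §9 Prop. (9.6)] -/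
theorem mem_decompositionSubgroup_smul_adicCompletionPrime_iff (γ x : absoluteGaloisGroup K) :
    x ∈ (γ • adicCompletionPrime K v).decompositionSubgroup (absoluteGaloisGroup K) ↔
      x ∈ ((MulAut.conj γ).toMonoidHom.comp
        (absGaloisRestrict K (v.adicCompletion K)).toMonoidHom).range := by
  rw [Ideal.decompositionSubgroup_smul (absoluteGaloisGroup K) (adicCompletionPrime K v) γ,
    Subgroup.mem_pointwise_smul_iff_inv_smul_mem, MulAut.smul_def, MulAut.conj_inv_apply,
    decompositionSubgroup_adicCompletionPrime_eq_range, MonoidHom.range_comp, Subgroup.mem_map]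
  constructor
  · rintro ⟨τ, hτ⟩
    have hτ' : absGaloisRestrict K (v.adicCompletion K) τ = γ⁻¹ * x * γ := hτ
    refine ⟨absGaloisRestrict K (v.adicCompletion K) τ, ⟨τ, rfl⟩, ?_⟩
    rw [MulEquiv.coe_toMonoidHom, MulAut.conj_apply, hτ']
    group
  · rintro ⟨_, ⟨τ, rfl⟩, hx⟩
    have hx' : γ * absGaloisRestrict K (v.adicCompletion K) τ * γ⁻¹ = x := hx
    refine ⟨τ, ?_⟩
    change absGaloisRestrict K (v.adicCompletion K) τ = γ⁻¹ * x * γ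
    rw [← hx']
    group

/-- **`D_𝔓 ↪ Γ_K` is relatively slim, given the slimness of `Γ_{K_v}`** (Mochizuki (2004),
Thm. 1.1.1 (ii), first clause): if every open subgroup of `Γ_{K_v}` has trivial centraliser in
`Γ_{K_v}`, then for every prime `𝔓 ∣ v` of `\bar ℤ_K` and every open subgroup `U` of `D_𝔓` (subspace
topology), the centraliser of `U` in `Γ_K` is trivial.  Proof: `U` has finite index in the compact
group `D_𝔓`, so `Z(U) ⊆ D_𝔓` (`centralizer_le_decompositionSubgroup_of_relIndex_ne_zero`); then
transport along the topological isomorphism `τ ↦ γ (res τ) γ⁻¹ : Γ_{K_v} ⥲ D_𝔓`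
(`absGaloisRestrict_adicCompletion_injective`). [cite: MochizukiAbsAnab2004, Thm 1.1.1 (ii) p.6] -/
theorem centralizer_image_decompositionSubgroup_eq_bot
    (hslim : ∀ V : Subgroup (absoluteGaloisGroup (v.adicCompletion K)),
      IsOpen (V : Set (absoluteGaloisGroup (v.adicCompletion K))) →
        Subgroup.centralizer (V : Set (absoluteGaloisGroup (v.adicCompletion K))) = ⊥)
    {𝔓 : Ideal (absIntegers (𝓞 K) K)} (h𝔓 : 𝔓 ∈ v.primesAbove)
    (U : Subgroup (𝔓.decompositionSubgroup (absoluteGaloisGroup K)))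
    (hU : IsOpen (U : Set (𝔓.decompositionSubgroup (absoluteGaloisGroup K)))) :
    Subgroup.centralizer ((𝔓.decompositionSubgroup (absoluteGaloisGroup K)).subtype ''
      (U : Set (𝔓.decompositionSubgroup (absoluteGaloisGroup K)))) = ⊥ := by
  classical
  -- `D_𝔓` is compact, so the open subgroup `U` has finite index
  have hDclosed : IsClosed ((𝔓.decompositionSubgroup (absoluteGaloisGroup K) :
      Subgroup (absoluteGaloisGroup K)) : Set (absoluteGaloisGroup K)) :=
    absIntegers.isClosed_decompositionSubgroup_holds (R := 𝓞 K) (K := K) 𝔓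
  haveI : CompactSpace (𝔓.decompositionSubgroup (absoluteGaloisGroup K)) :=
    isCompact_iff_compactSpace.mp hDclosed.isCompact
  haveI : Finite ((𝔓.decompositionSubgroup (absoluteGaloisGroup K)) ⧸ U) :=
    Subgroup.quotient_finite_of_isOpen U hU
  have hindex : U.index ≠ 0 := Subgroup.index_ne_zero_of_finite
  have hle : U.map (𝔓.decompositionSubgroup (absoluteGaloisGroup K)).subtype ≤
      𝔓.decompositionSubgroup (absoluteGaloisGroup K) := Subgroup.map_subtype_le U
  have hfin : (U.map (𝔓.decompositionSubgroup (absoluteGaloisGroup K)).subtype).relIndex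
      (𝔓.decompositionSubgroup (absoluteGaloisGroup K)) ≠ 0 := by
    rw [Subgroup.relIndex, Subgroup.subgroupOf,
      Subgroup.comap_map_eq_self_of_injective (Subgroup.subtype_injective _)]
    exact hindex
  have himage : ((𝔓.decompositionSubgroup (absoluteGaloisGroup K)).subtype ''
      (U : Set (𝔓.decompositionSubgroup (absoluteGaloisGroup K)))) =
      ((U.map (𝔓.decompositionSubgroup (absoluteGaloisGroup K)).subtype :
        Subgroup (absoluteGaloisGroup K)) : Set (absoluteGaloisGroup K)) :=
    (Subgroup.coe_map _ U).symm
  refine (Subgroup.eq_bot_iff_forall _).mpr fun σ hσ => ?_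
  -- Step 1: `σ ∈ D_𝔓`
  have hσD : σ ∈ 𝔓.decompositionSubgroup (absoluteGaloisGroup K) := by
    refine centralizer_le_decompositionSubgroup_of_relIndex_ne_zero K v h𝔓 hle hfin ?_
    rwa [← himage]
  -- Step 2: transport the slimness of `Γ_{K_v}` along `τ ↦ γ (res τ) γ⁻¹ : Γ_{K_v} ⥲ D_𝔓`
  obtain ⟨γ, hγ⟩ := HeightOneSpectrum.exists_smul_eq_of_mem_primesAbove_holds
    (adicCompletionPrime_mem_primesAbove K v) h𝔓
  let f : absoluteGaloisGroup (v.adicCompletion K) →* absoluteGaloisGroup K :=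
    (MulAut.conj γ).toMonoidHom.comp (absGaloisRestrict K (v.adicCompletion K)).toMonoidHom
  have hfapply : ∀ τ, f τ = γ * absGaloisRestrict K (v.adicCompletion K) τ * γ⁻¹ := fun _ => rfl
  have hfcont : Continuous f := by
    have : (f : absoluteGaloisGroup (v.adicCompletion K) → absoluteGaloisGroup K) =
        fun τ => γ * absGaloisRestrict K (v.adicCompletion K) τ * γ⁻¹ := funext hfapply
    rw [this]
    exact ((absGaloisRestrict K (v.adicCompletion K)).continuous.const_mul γ).mul_const γ⁻¹
  have hfinj : Function.Injective f := by
    intro a b hab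
    apply absGaloisRestrict_adicCompletion_injective K v
    rw [hfapply, hfapply] at hab
    exact mul_left_cancel (mul_right_cancel hab)
  have hDf : ∀ x, x ∈ 𝔓.decompositionSubgroup (absoluteGaloisGroup K) ↔ x ∈ f.range := by
    intro x
    rw [← hγ]
    exact mem_decompositionSubgroup_smul_adicCompletionPrime_iff K v γ x
  exact eq_one_of_forall_centralizer_eq_bot f hfcont hfinj hslim _ hDf U hU hσD hσ

end Literature.NumberTheory.GaloisRepresentations
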